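import Summits.Ventures.PercRepro.Night2TwoOneFatFaces

/-!
# PercRepro — the cell `(2, 1)` with two fat closures: the structure of a loaded target (night-2, gen 28)

Spread regime of the two-fat-closure clause (`hsp`: thin members miss `2` or `≥ 7` points; at most two fat closures
`H₀ = cl B₀`, `H₁ = cl B₁`; disjoint missed pairs `G ∖ H₀`, `G ∖ H₁` — the four OFF-PLANE points, two per class;
`P = (H₀ ∩ H₁) ∖ K` the plane).  A set `Q` with a lossy big face (`faceLossP ≠ 0`, `Night2TwoOneFatFaces`) meets
each class exactly once, `Q ∖ K` has rank `5` and `≥ 6` points, its plane part `Q ∩ P` has rank `≥ 3` and `≥ 4` points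
(`structure_of_faceLossP_ne_zero`); in a three-point class trace at most two points leave one point per class
(`card_filter_le_two_of_singletons`); adding a point of each class to a subset of `H₀ ∩ H₁` raises the rank by two
(`rkN_add_two_le_of_classes`), so a thin face at a class point needs the other point of its class outside the set
(`class_inter_eq_singleton_of_thin_face`).  The column bound itself is assembled in `Night2TwoOneColumnB`.
-/

namespace PercRepro.Shadow

open Finset PerFlat ThmH

variable {α : Type*} [DecidableEq α] {M : Matroid α} [M.Finite]

section Column

variable {G : Finset α}

/-- A rank-`6` set with a face inside a rank-`5` set `H` meets `G ∖ H` exactly at the erased point. -/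
theorem inter_missed_eq_singleton {Q H : Finset α} (hQG : Q ⊆ G) (hQ6 : rkN M Q = 6) (hH5 : rkN M H ≤ 5)
    {u : α} (huQ : u ∈ Q) (hsub : Q.erase u ⊆ H) : Q ∩ (G \ H) = {u} := by
  have huH : u ∉ H := by
    intro huH
    have hQH : Q ⊆ H := by
      intro x hx
      by_cases hxu : x = u
      · rw [hxu]; exact huH
      · exact hsub (Finset.mem_erase.2 ⟨hxu, hx⟩)
    have := rkN_mono (M := M) hQH
    omega
  ext x
  rw [Finset.mem_inter, Finset.mem_sdiff, Finset.mem_singleton]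
  constructor
  · rintro ⟨hxQ, -, hxH⟩
    by_contra hxu
    exact hxH (hsub (Finset.mem_erase.2 ⟨hxu, hxQ⟩))
  · rintro rfl
    exact ⟨huQ, hQG huQ, huH⟩

open scoped Classical in
/-- **A SET WITH A LOSSY BIG FACE MEETS EACH CLASS ONCE** (cell `(2, 1)`, spread regime, two fat closures with
disjoint missed pairs): `Q ∩ (G ∖ H₀) = {u}`, `Q ∩ (G ∖ H₁) = {u′}`, `K ⊆ Q ⊆ G`, `Q ∖ K` has rank `5` and `≥ 6` points,
and the plane part `Q ∩ P` has rank `≥ 3` and `≥ 4` points. -/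
theorem structure_of_faceLossP_ne_zero (hG : G ∈ flatsQ M (5 + 1)) (hd : (gr M \ G).card = 2)
    (hk : kColoops M G = 1) (hs : ∀ e ∈ gr M, ∀ f ∈ gr M, e ≠ f → rkN M {e, f} = 2)
    (hl : ∀ e ∈ gr M, M.Indep {e}) {B₀ B₁ : Finset α} (hB₀ : B₀ ∈ thinMembers M 5 G)
    (hB₁ : B₁ ∈ thinMembers M 5 G) (hm₀ : (G \ clF M B₀).card ≤ 2) (hm₁ : (G \ clF M B₁).card ≤ 2)
    (hne : clF M B₀ ≠ clF M B₁) (hfat : (fatClosures M 5 G 2).card ≤ 2)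
    (hsp : ∀ B ∈ thinMembers M 5 G, 2 < (G \ clF M B).card → 7 ≤ (G \ clF M B).card) {Q : Finset α}
    (hQ : ∃ w ∈ Q, faceLossP M 5 G (fun B => 5 ≤ (B \ coloops M G).card) Q w ≠ 0) :
    ∃ u u', u ≠ u' ∧ Q ∩ (G \ clF M B₀) = {u} ∧ Q ∩ (G \ clF M B₁) = {u'} ∧ Q ⊆ G ∧ coloops M G ⊆ Q ∧
      rkN M (Q \ coloops M G) = 5 ∧ 6 ≤ (Q \ coloops M G).card ∧
      3 ≤ rkN M (Q ∩ ((clF M B₀ ∩ clF M B₁) \ coloops M G)) ∧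
      4 ≤ (Q ∩ ((clF M B₀ ∩ clF M B₁) \ coloops M G)).card ∧ 4 ≤ (G \ Q).card := by
  have hd' : (gr M \ G).card ≤ 5 := by omega
  obtain ⟨w₀, hw₀, hne0⟩ := hQ
  have hcond : Q.erase w₀ ∈ thinMembers M 5 G ∧ 5 ≤ (Q.erase w₀ \ coloops M G).card ∧
      w₀ ∈ G \ clF M (Q.erase w₀) := by
    unfold faceLossP at hne0
    by_contra h
    rw [if_neg h] at hne0
    exact hne0 rfl
  have hloss : loss M 5 G (Q.erase w₀) w₀ ≠ 0 := by
    unfold faceLossP at hne0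
    rwa [if_pos hcond] at hne0
  have hQeq : insert w₀ (Q.erase w₀) = Q := Finset.insert_erase hw₀
  obtain ⟨B, hB⟩ : ∃ B, B = Q.erase w₀ := ⟨_, rfl⟩
  rw [← hB] at hcond hloss hQeq
  have hBU : B ∈ Uq M (5 + 2) 5 := (mem_membersIn.1 (mem_thinMembers.1 hcond.1).1).1
  have hBG : B ⊆ G := (subset_clF hBU).trans (mem_membersIn.1 (mem_thinMembers.1 hcond.1).1).2
  have hKB : coloops M G ⊆ B := coloops_subset_of_mem_thinMembers hG hd' hcond.1
  have hQG : Q ⊆ G := by rw [← hQeq]; exact Finset.insert_subset (Finset.mem_sdiff.1 hcond.2.2).1 hBG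
  have hKQ : coloops M G ⊆ Q := by rw [← hQeq]; exact hKB.trans (Finset.subset_insert _ _)
  have hQ6 : rkN M Q = 6 := by rw [← hQeq]; exact rkN_insert_eq_six_of_thin hG hcond.1 hcond.2.2
  have hQK5 : rkN M (Q \ coloops M G) = 5 := by
    rw [← hQeq]; exact rkN_insert_sdiff_coloops_eq_five_of_thin hG hd hk hcond.1 hcond.2.2
  have hw₀B : w₀ ∉ B := notMem_of_notMem_clF hBU (Finset.mem_sdiff.1 hcond.2.2).2
  have hw₀K : w₀ ∉ coloops M G := fun h => hw₀B (hKB h)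
  have hQKcard : 6 ≤ (Q \ coloops M G).card := by
    rw [← hQeq, Finset.insert_sdiff_of_notMem _ hw₀K, Finset.card_insert_of_notMem
      (fun h => hw₀B (Finset.mem_sdiff.1 h).1)]
    omega
  obtain ⟨-, u, huQ, u', hu'Q, huu', hFu, hclu, hFu', hclu'⟩ :=
    two_fat_faces_of_loss_ne_zero hG hd hk hs hl hB₀ hB₁ hm₀ hm₁ hne hfat hsp hcond.1 hcond.2.1 hcond.2.2 hloss
  rw [hQeq] at huQ hu'Q hFu hclu hFu' hclu'
  have hB₀U : B₀ ∈ Uq M (5 + 2) 5 := (mem_membersIn.1 (mem_thinMembers.1 hB₀).1).1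
  have hB₁U : B₁ ∈ Uq M (5 + 2) 5 := (mem_membersIn.1 (mem_thinMembers.1 hB₁).1).1
  have hsub₀ : Q.erase u ⊆ clF M B₀ := by
    rw [← hclu]; exact subset_clF (mem_membersIn.1 (mem_thinMembers.1 hFu).1).1
  have hsub₁ : Q.erase u' ⊆ clF M B₁ := by
    rw [← hclu']; exact subset_clF (mem_membersIn.1 (mem_thinMembers.1 hFu').1).1
  have h₀ := inter_missed_eq_singleton hQG hQ6 (rkN_clF_eq_five_of_mem_Uq hB₀U).le huQ hsub₀
  have h₁ := inter_missed_eq_singleton hQG hQ6 (rkN_clF_eq_five_of_mem_Uq hB₁U).le hu'Q hsub₁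
  refine ⟨u, u', huu', h₀, h₁, hQG, hKQ, hQK5, hQKcard, ?_, ?_, ?_⟩
  -- `Q ∖ K ⊆ (Q ∩ P) ∪ {u, u′}`
  · have hsub : Q \ coloops M G ⊆ (Q ∩ ((clF M B₀ ∩ clF M B₁) \ coloops M G)) ∪ {u, u'} := by
      intro x hx
      rw [Finset.mem_sdiff] at hx
      rw [Finset.mem_union, Finset.mem_inter, Finset.mem_sdiff, Finset.mem_inter, Finset.mem_insert,
        Finset.mem_singleton]
      by_cases h0 : x ∈ clF M B₀
      · by_cases h1 : x ∈ clF M B₁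
        · exact Or.inl ⟨hx.1, ⟨h0, h1⟩, hx.2⟩
        · right; right
          have : x ∈ Q ∩ (G \ clF M B₁) := Finset.mem_inter.2 ⟨hx.1, Finset.mem_sdiff.2 ⟨hQG hx.1, h1⟩⟩
          rw [h₁, Finset.mem_singleton] at this
          exact this
      · right; left
        have : x ∈ Q ∩ (G \ clF M B₀) := Finset.mem_inter.2 ⟨hx.1, Finset.mem_sdiff.2 ⟨hQG hx.1, h0⟩⟩
        rw [h₀, Finset.mem_singleton] at this
        exact this
    have h1 := rkN_mono (M := M) hsub
    have h2 := rkN_union_le_add_card (M := M) (Q ∩ ((clF M B₀ ∩ clF M B₁) \ coloops M G)) {u, u'}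
    rw [Finset.card_pair huu'] at h2
    omega
  · have hsub : Q \ coloops M G ⊆ (Q ∩ ((clF M B₀ ∩ clF M B₁) \ coloops M G)) ∪ {u, u'} := by
      intro x hx
      rw [Finset.mem_sdiff] at hx
      rw [Finset.mem_union, Finset.mem_inter, Finset.mem_sdiff, Finset.mem_inter, Finset.mem_insert,
        Finset.mem_singleton]
      by_cases h0 : x ∈ clF M B₀
      · by_cases h1 : x ∈ clF M B₁
        · exact Or.inl ⟨hx.1, ⟨h0, h1⟩, hx.2⟩
        · right; right
          have : x ∈ Q ∩ (G \ clF M B₁) := Finset.mem_inter.2 ⟨hx.1, Finset.mem_sdiff.2 ⟨hQG hx.1, h1⟩⟩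
          rw [h₁, Finset.mem_singleton] at this
          exact this
      · right; left
        have : x ∈ Q ∩ (G \ clF M B₀) := Finset.mem_inter.2 ⟨hx.1, Finset.mem_sdiff.2 ⟨hQG hx.1, h0⟩⟩
        rw [h₀, Finset.mem_singleton] at this
        exact this
    have h1 := Finset.card_le_card hsub
    have h2 := Finset.card_union_le (Q ∩ ((clF M B₀ ∩ clF M B₁) \ coloops M G)) {u, u'}
    rw [Finset.card_pair huu'] at h2
    omega
  -- the complement of the fat face `Q ∖ u` spans: `|G ∖ Q| + 1 ≥ 5`
  · have hFuU : Q.erase u ∈ Uq M (5 + 2) 5 := (mem_membersIn.1 (mem_thinMembers.1 hFu).1).1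
    have h5 := five_le_rkN_sdiff_of_mem_Uq_two hG hd hFuU ((Finset.erase_subset u Q).trans hQG)
    have hsub : G \ Q.erase u ⊆ insert u (G \ Q) := by
      intro x hx
      rw [Finset.mem_sdiff, Finset.mem_erase, not_and] at hx
      rw [Finset.mem_insert, Finset.mem_sdiff]
      by_cases hxu : x = u
      · exact Or.inl hxu
      · exact Or.inr ⟨hx.1, hx.2 hxu⟩
    have h1 := rkN_mono (M := M) hsub
    have h2 := rkN_le_card (M := M) (insert u (G \ Q))
    have h3 := Finset.card_insert_le u (G \ Q)
    omega

/-- **At most two points `y` of a three-point trace `S ∩ (A ∪ B)` leave one point in each of the disjoint classes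
`A`, `B`**: the lone point of the class met once never does. -/
theorem card_filter_le_two_of_singletons {A B S N : Finset α} (hAB : Disjoint A B) (hN : N ⊆ (A ∪ B) ∩ S)
    (hsing : ∀ y ∈ N, (∃ u, (S.erase y) ∩ A = {u}) ∧ ∃ u', (S.erase y) ∩ B = {u'}) : N.card ≤ 2 := by
  rcases N.eq_empty_or_nonempty with hN0 | ⟨y₁, hy₁⟩
  · rw [hN0, Finset.card_empty]; omega
  · have hy₁' := hN hy₁
    rw [Finset.mem_inter, Finset.mem_union] at hy₁'
    obtain ⟨⟨u₁, hu₁⟩, ⟨u₁', hu₁'⟩⟩ := hsing y₁ hy₁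
    -- the class of `y₁` has two points in `S`, the other class one
    rcases hy₁'.1 with hy₁A | hy₁B
    · -- `S ∩ B = {u₁′}`, so every `y ∈ N` lies in `A`, and `N ⊆ S ∩ A` which has two points
      have hSB : S ∩ B = {u₁'} := by
        rw [← hu₁']
        ext x
        simp only [Finset.mem_inter, Finset.mem_erase]
        constructor
        · rintro ⟨hxS, hxB⟩
          refine ⟨⟨fun hxy => ?_, hxS⟩, hxB⟩
          rw [hxy] at hxB
          exact Finset.disjoint_left.1 hAB hy₁A hxB
        · rintro ⟨⟨-, hxS⟩, hxB⟩
          exact ⟨hxS, hxB⟩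
      have hSA : S ∩ A = insert y₁ ((S.erase y₁) ∩ A) := by
        ext x
        simp only [Finset.mem_inter, Finset.mem_insert, Finset.mem_erase]
        constructor
        · rintro ⟨hxS, hxA⟩
          by_cases hxy : x = y₁
          · exact Or.inl hxy
          · exact Or.inr ⟨⟨hxy, hxS⟩, hxA⟩
        · rintro (rfl | ⟨⟨-, hxS⟩, hxA⟩)
          · exact ⟨hy₁'.2, hy₁A⟩
          · exact ⟨hxS, hxA⟩
      have hNA : N ⊆ S ∩ A := by
        intro y hy
        have hy' := hN hy
        rw [Finset.mem_inter, Finset.mem_union] at hy'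
        rcases hy'.1 with hyA | hyB
        · exact Finset.mem_inter.2 ⟨hy'.2, hyA⟩
        · exfalso
          obtain ⟨⟨u, hu⟩, ⟨u', hu'⟩⟩ := hsing y hy
          -- `(S ∖ y) ∩ B = ∅` since `S ∩ B = {y}`
          have hyB' : y ∈ S ∩ B := Finset.mem_inter.2 ⟨hy'.2, hyB⟩
          rw [hSB, Finset.mem_singleton] at hyB'
          have : u' ∈ (S.erase y) ∩ B := by rw [hu']; exact Finset.mem_singleton_self _
          rw [Finset.mem_inter, Finset.mem_erase] at this
          have hu'S : u' ∈ S ∩ B := Finset.mem_inter.2 ⟨this.1.2, this.2⟩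
          rw [hSB, Finset.mem_singleton] at hu'S
          exact this.1.1 (hu'S.trans hyB'.symm)
      have h1 := Finset.card_le_card hNA
      rw [hSA, hu₁] at h1
      have h2 := Finset.card_insert_le y₁ ({u₁} : Finset α)
      rw [Finset.card_singleton] at h2
      omega
    · have hSA : S ∩ A = {u₁} := by
        rw [← hu₁]
        ext x
        simp only [Finset.mem_inter, Finset.mem_erase]
        constructor
        · rintro ⟨hxS, hxA⟩
          refine ⟨⟨fun hxy => ?_, hxS⟩, hxA⟩
          rw [hxy] at hxA
          exact Finset.disjoint_left.1 hAB hxA hy₁B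
        · rintro ⟨⟨-, hxS⟩, hxA⟩
          exact ⟨hxS, hxA⟩
      have hSB : S ∩ B = insert y₁ ((S.erase y₁) ∩ B) := by
        ext x
        simp only [Finset.mem_inter, Finset.mem_insert, Finset.mem_erase]
        constructor
        · rintro ⟨hxS, hxB⟩
          by_cases hxy : x = y₁
          · exact Or.inl hxy
          · exact Or.inr ⟨⟨hxy, hxS⟩, hxB⟩
        · rintro (rfl | ⟨⟨-, hxS⟩, hxB⟩)
          · exact ⟨hy₁'.2, hy₁B⟩
          · exact ⟨hxS, hxB⟩
      have hNB : N ⊆ S ∩ B := by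
        intro y hy
        have hy' := hN hy
        rw [Finset.mem_inter, Finset.mem_union] at hy'
        rcases hy'.1 with hyA | hyB
        · exfalso
          obtain ⟨⟨u, hu⟩, ⟨u', hu'⟩⟩ := hsing y hy
          have hyA' : y ∈ S ∩ A := Finset.mem_inter.2 ⟨hy'.2, hyA⟩
          rw [hSA, Finset.mem_singleton] at hyA'
          have : u ∈ (S.erase y) ∩ A := by rw [hu]; exact Finset.mem_singleton_self _
          rw [Finset.mem_inter, Finset.mem_erase] at this
          have huS : u ∈ S ∩ A := Finset.mem_inter.2 ⟨this.1.2, this.2⟩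
          rw [hSA, Finset.mem_singleton] at huS
          exact this.1.1 (huS.trans hyA'.symm)
        · exact Finset.mem_inter.2 ⟨hy'.2, hyB⟩
      have h1 := Finset.card_le_card hNB
      rw [hSB, hu₁'] at h1
      have h2 := Finset.card_insert_le y₁ ({u₁'} : Finset α)
      rw [Finset.card_singleton] at h2
      omega

/-- Adding a point of each class to a subset of `H₀ ∩ H₁` raises the rank by two (disjoint missed pairs). -/
theorem rkN_add_two_le_of_classes (hG : G ∈ flatsQ M (5 + 1)) {B₀ B₁ : Finset α}
    (hdisj : Disjoint (G \ clF M B₀) (G \ clF M B₁)) {X : Finset α} (hX : X ⊆ clF M B₀ ∩ clF M B₁)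
    {u u' : α} (hu : u ∈ G \ clF M B₀) (hu' : u' ∈ G \ clF M B₁) :
    rkN M X + 2 ≤ rkN M (insert u (insert u' X)) := by
  have hGg : G ⊆ gr M := (mem_flatsQ.1 hG).1
  have hu'H₀ : u' ∈ clF M B₀ := by
    by_contra h
    exact Finset.disjoint_left.1 hdisj (Finset.mem_sdiff.2 ⟨(Finset.mem_sdiff.1 hu').1, h⟩) hu'
  have h1 : rkN M (insert u' X) = rkN M X + 1 := by
    apply rkN_insert_of_notMem_clF (hGg (Finset.mem_sdiff.1 hu').1)
    intro h
    have : clF M X ⊆ clF M B₁ := by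
      have := clF_mono (M := M) (hX.trans Finset.inter_subset_right)
      rwa [clF_clF] at this
    exact (Finset.mem_sdiff.1 hu').2 (this h)
  have h2 : rkN M (insert u (insert u' X)) = rkN M (insert u' X) + 1 := by
    apply rkN_insert_of_notMem_clF (hGg (Finset.mem_sdiff.1 hu).1)
    intro h
    have hsub : insert u' X ⊆ clF M B₀ := Finset.insert_subset hu'H₀ (hX.trans Finset.inter_subset_left)
    have : clF M (insert u' X) ⊆ clF M B₀ := by
      have := clF_mono (M := M) hsub
      rwa [clF_clF] at this
    exact (Finset.mem_sdiff.1 hu).2 (this h)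
  omega

open scoped Classical in
/-- A thin face `S ∖ w` at a class point `w` needs the other point of its class outside `S` (given points of both
classes in `S` and a plane part of rank `≥ 3`): here for the class `G ∖ H₀`. -/
theorem class_inter_eq_singleton_of_thin_face (hG : G ∈ flatsQ M (5 + 1)) (hd : (gr M \ G).card = 2)
    (hk : kColoops M G = 1) {B₀ B₁ : Finset α} (hB₀ : B₀ ∈ thinMembers M 5 G) (hB₁ : B₁ ∈ thinMembers M 5 G)
    (hdisj : Disjoint (G \ clF M B₀) (G \ clF M B₁))
    {S : Finset α} (hSP : 3 ≤ rkN M (S ∩ ((clF M B₀ ∩ clF M B₁) \ coloops M G)))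
    {u' : α} (hu' : u' ∈ S ∩ (G \ clF M B₁)) {w : α} (hw : w ∈ S ∩ (G \ clF M B₀))
    (hthin : S.erase w ∈ thinMembers M 5 G) : (G \ clF M B₀) ∩ S = {w} := by
  have hd' : (gr M \ G).card ≤ 5 := by omega
  have hKH₀ : coloops M G ⊆ clF M B₀ := (coloops_subset_of_mem_thinMembers hG hd' hB₀).trans
    (subset_clF (mem_membersIn.1 (mem_thinMembers.1 hB₀).1).1)
  have hKH₁ : coloops M G ⊆ clF M B₁ := (coloops_subset_of_mem_thinMembers hG hd' hB₁).trans
    (subset_clF (mem_membersIn.1 (mem_thinMembers.1 hB₁).1).1)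
  ext x
  rw [Finset.mem_inter, Finset.mem_singleton]
  constructor
  · rintro ⟨hxH₀, hxS⟩
    by_contra hxw
    -- `(S ∖ w) ∖ K ⊇ (S ∩ P) ∪ {x, u′}` has rank `≥ 5`
    have h4 := rkN_sdiff_coloops_eq_four_of_thin hG hd hk hthin
    have hX : S ∩ ((clF M B₀ ∩ clF M B₁) \ coloops M G) ⊆ clF M B₀ ∩ clF M B₁ :=
      Finset.inter_subset_right.trans Finset.sdiff_subset
    have h2 := rkN_add_two_le_of_classes hG hdisj hX hxH₀ (Finset.mem_inter.1 hu').2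
    have hsub : insert x (insert u' (S ∩ ((clF M B₀ ∩ clF M B₁) \ coloops M G))) ⊆ S.erase w \ coloops M G := by
      intro y hy
      rw [Finset.mem_insert, Finset.mem_insert] at hy
      rw [Finset.mem_sdiff, Finset.mem_erase]
      rcases hy with rfl | rfl | hy
      · exact ⟨⟨hxw, hxS⟩, fun h => (Finset.mem_sdiff.1 hxH₀).2 (hKH₀ h)⟩
      · refine ⟨⟨?_, (Finset.mem_inter.1 hu').1⟩, fun h => (Finset.mem_sdiff.1 (Finset.mem_inter.1 hu').2).2 (hKH₁ h)⟩
        intro h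
        rw [h] at hu'
        exact Finset.disjoint_left.1 hdisj (Finset.mem_inter.1 hw).2 (Finset.mem_inter.1 hu').2
      · rw [Finset.mem_inter, Finset.mem_sdiff, Finset.mem_inter] at hy
        refine ⟨⟨?_, hy.1⟩, hy.2.2⟩
        intro h
        rw [h] at hy
        exact (Finset.mem_sdiff.1 (Finset.mem_inter.1 hw).2).2 hy.2.1.1
    have := rkN_mono (M := M) hsub
    omega
  · rintro rfl
    exact ⟨(Finset.mem_inter.1 hw).2, (Finset.mem_inter.1 hw).1⟩

open scoped Classical in
/-- The mirror image: a thin face at a point of the class `G ∖ H₁`. -/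
theorem class_inter_eq_singleton_of_thin_face' (hG : G ∈ flatsQ M (5 + 1)) (hd : (gr M \ G).card = 2)
    (hk : kColoops M G = 1) {B₀ B₁ : Finset α} (hB₀ : B₀ ∈ thinMembers M 5 G) (hB₁ : B₁ ∈ thinMembers M 5 G)
    (hdisj : Disjoint (G \ clF M B₀) (G \ clF M B₁))
    {S : Finset α} (hSP : 3 ≤ rkN M (S ∩ ((clF M B₀ ∩ clF M B₁) \ coloops M G)))
    {u : α} (hu : u ∈ S ∩ (G \ clF M B₀)) {w : α} (hw : w ∈ S ∩ (G \ clF M B₁))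
    (hthin : S.erase w ∈ thinMembers M 5 G) : (G \ clF M B₁) ∩ S = {w} := by
  have hdisj' : Disjoint (G \ clF M B₁) (G \ clF M B₀) := hdisj.symm
  have hSP' : 3 ≤ rkN M (S ∩ ((clF M B₁ ∩ clF M B₀) \ coloops M G)) := by
    rwa [Finset.inter_comm (clF M B₁)]
  exact class_inter_eq_singleton_of_thin_face hG hd hk hB₁ hB₀ hdisj' hSP' hu hw hthin

end Column

end PercRepro.Shadow
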